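/-
Copyright: b2b-lace packet (literature seat, gen 11).  `ℤ^d` is bipartite along lattice words: `k + ‖W(k)‖₁` is even.
-/
import Literature.Probability.FitznerVanDerHofstad2017.SrwFarNodeBound
import Literature.Probability.Percolation.DualContours
import HarnessLib

/-!
# Parity of lattice words (`ℤ^d` is bipartite)

For a lattice word `w ∈ ({1,…,d} × {±})ⁿ` with partial positions `wordPos w k`, the quantity `k + ‖wordPos w k‖₁` is
even; hence a word of length `n` can end at `x` only if `n ≡ ‖x‖₁ (mod 2)`, and a word of odd length does not return to
the origin.  This is the elementary lattice fact behind the parity choices of the NoBLE verification notebook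
("we have to choose M = Rsteps even to apply the bound", `Percolation.nb`, cell before the `G_{m,z}(e₁)` bound) and
behind REFEREE R13.4 of the b2b-lace packet; the simple-random-walk form `p_n(x) = 0` for `n + ‖x‖₁` odd is
`srwLaw_eq_zero_of_odd` (`SrwFarNodeBound`).  [folklore]

## References
* [Gri99] G. Grimmett, Percolation, 2nd ed., Springer 1999 — §1.4 p. 15 (lattice words / paths of `𝕃^d`).
* [NoBLE17] R. Fitzner, R. van der Hofstad, Generalized approach to the non-backtracking lace expansion,
  Probab. Theory Relat. Fields 169 (2017) 1041–1119 — (5.1) p. 1090 (the walk counts `p_m(x)`, parity-vanishing).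
-/

namespace Literature.Probability.Percolation

open Literature.Probability.LatticeModels Literature.Probability.FitznerVanDerHofstad2017
open scoped BigOperators

variable {d : ℕ}

/-- One lattice step flips the parity of `‖x‖₁`: `‖x + stepVec a‖₁ ≡ ‖x‖₁ + 1 (mod 2)`. [folklore] -/
theorem sum_natAbs_add_stepVec_mod_two (x : Site d) (a : Fin d × Bool) :
    (∑ i, ((x + stepVec a) i).natAbs) % 2 = ((∑ i, (x i).natAbs) + 1) % 2 := by
  obtain ⟨j, b⟩ := a
  cases b
  · have h : x + stepVec (j, false) = x - Pi.single j 1 := by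
      simp [stepVec, sub_eq_add_neg]
    rw [h]
    exact sum_natAbs_sub_single_mod_two x j
  · have h : x + stepVec (j, true) = x + Pi.single j 1 := by simp [stepVec]
    rw [h]
    exact sum_natAbs_add_single_mod_two x j

/-- **`ℤ^d` is bipartite along words**: `k + ‖wordPos w k‖₁` is even for every `k ≤ n`. [folklore] -/
theorem wordPos_parity {n : ℕ} (w : Fin n → Fin d × Bool) :
    ∀ {k : ℕ}, k ≤ n → (k + ∑ i, ((wordPos w k) i).natAbs) % 2 = 0
  | 0, _ => by simp
  | k + 1, hk => by
    have ih := wordPos_parity w (Nat.le_of_succ_le hk)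
    have h := sum_natAbs_add_stepVec_mod_two (wordPos w k) (w ⟨k, Nat.lt_of_succ_le hk⟩)
    rw [wordPos_succ w (Nat.lt_of_succ_le hk)]
    omega

/-- A word of length `n` ends at `x` only if `n ≡ ‖x‖₁ (mod 2)`. [folklore] -/
theorem wordPos_ne_of_odd {n : ℕ} (w : Fin n → Fin d × Bool) (x : Site d)
    (hx : (n + ∑ i, (x i).natAbs) % 2 = 1) : wordPos w n ≠ x := by
  intro h
  have hp := wordPos_parity w (le_refl n)
  rw [h] at hp
  omega

/-- A word of odd length does not return to the origin (closed lattice paths have even length). [folklore] -/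
theorem wordPos_ne_zero_of_odd {n : ℕ} (w : Fin n → Fin d × Bool) (hn : n % 2 = 1) : wordPos w n ≠ 0 :=
  wordPos_ne_of_odd w 0 (by simpa using hn)

/-- Equivalently: if a word of length `n` ends at `x` then `n + ‖x‖₁` is even. [folklore] -/
theorem even_add_sum_natAbs_of_wordPos_eq {n : ℕ} (w : Fin n → Fin d × Bool) {x : Site d}
    (h : wordPos w n = x) : (n + ∑ i, (x i).natAbs) % 2 = 0 := by
  rw [← h]
  exact wordPos_parity w (le_refl n)

end Literature.Probability.Percolation
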